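import Literature.NumberTheory.LFunctions.DeuringPhenomenonDeepStripPerron
import Literature.NumberTheory.LFunctions.DeuringPhenomenonElementaryTheoremTwoProofs
import Literature.NumberTheory.LFunctions.ElementaryDeuringHeilbronnPhenomenon
import Literature.Computability.Cryptography.HallgrenClassGroupIdealCount
import Literature.NumberTheory.DiophantineGeometry.AbcWave0GranvilleStarkTheorem2Proofs
import HarnessLib

/-!
# Bellotti–Puglisi's Lemma 2: `Σ_{n≤q} g(n) n^{−s} = L(s,χ)ζ(s) + O(q^{−ℓ/2})` on `H(ℓ, q)` for a field
# with `h(−q) ≤ log q` — the class-number input (ideal counts class by class) on top of the smoothed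
# Perron formula; and the by-product `Σ_{n≤N} g(n)/√n ≤ h(16√(N/q) + 4 log N + 5)`

Topic `Literature/NumberTheory/LFunctions` (namespace `Literature.NumberTheory.LFunctions`, helpers in the
statement file's grouping sub-namespace `BellottiPuglisi2023`). PROOF LAYER (theorems only; no definition,
no named fact, no new hypothesis): the second tool towards the named facts `bellottiPuglisi2023_theorem1` /
`_corollary1` of `ElementaryDeuringHeilbronnPhenomenon.lean` (cell `parity-realchar`, SIEGEL INSTRUMENT,
conditionals column, the Deuring direction). Source: C. Bellotti, G. Puglisi, *Elementary methods in the
study of the Deuring–Heilbronn phenomenon*, Acta Arith. **208** (2023) 257–277 = arXiv:2201.03990v3, §2,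
Lemma 2 (p. 6) and the second half of the proof of Lemma 4 (p. 8).

PRINT (p. 6): "**Lemma 2.** If `s ∈ H(ℓ, q)` and the following inequality `h(−q) ≤ log q/(log log q)^η`
holds, then the relation `Σ_{n≤q} g(n) n^{−s} = L(s,χ)ζ(s) + O(exp{−⅓ log q/(log log q)^μ})` holds.
*Proof.* First of all, we suppose that `½ + ℓ ≤ σ ≤ 7/8`. We know that `Σ_{n≤q} g(n) n^{−s}(1 − n/q)² =
Σ g(n)n^{−s} − (2/q)Σ g(n) n n^{−s} + (1/q²)Σ g(n) n² n^{−s}`. Using Lemma 1 we have […]. Now, if we use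
Dirichlet's Class Number Formula (see Davenport [3], chapter 6) and Lemma 1 of [24], it follows that
`(1/q)Σ_{n≤q} g(n) n^{1−s} ≪ q^{−½−ℓ} Σ_{n≤q} g(n) ≪ q^{½−ℓ} L(1,χ) ≪ q^{−ℓ} h(−q) ≪ q^{−ℓ} log q/(log log q)^η
= […] ≪ exp{−½ log q/(log log q)^μ}` […] Furthermore, we observe that `|s| log²(1+|s|) exp{−½ log q/
(log log q)^μ} ≤ q^{ℓ/10}(log q/(log log q)^μ)² exp{…}` […] `≪ exp{−⅓ log q/(log log q)^μ}` […] So, we proved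
the claim for `½ + ℓ ≤ σ ≤ 7/8`. If `7/8 < σ < 1`, we can conclude as in Lemma 3 of [24]." and (p. 8, proof
of Lemma 4): "`Σ_{√q/2<p≤q, χ(p)=1} p^{−σ} ≤ Σ_{√q/2<n≤q} g(n)n^{−σ} ≪ q^{−ℓ/2} Σ_{√q/2<n≤q} g(n)n^{−½}` […]
using Lemma A of [24] (for the proof see Goldfeld [8], p. 637) […] `≪ H q^{(1−ℓ)/2} L(1,χ)` […]".

HERE ("Lemma 1 of [24]" = Puglisi, Boll. UMI (6) 3-A (1984), and "Lemma A" = Goldfeld 1976 p. 637, are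
both the class-by-class lattice-point count of the ideals of bounded norm; the tree has it as
`Hallgren2005.card_nonzero_ideals_le_classNumber_mul`: `#{𝔞 ≠ 0 : N𝔞 ≤ N} ≤ ½ h_K (16N/√|d_K| + 8√N + 1)`):

* `BellottiPuglisi2023.sum_charDivisorSum_eq_ncard` / `sum_charDivisorSum_le` — for the imaginary quadratic
  field `K` with `d_K = −D` and the odd real primitive `χ` mod `D`, `Σ_{n≤N} g(n) = #{𝔞 ≠ 0 : N𝔞 ≤ N}`
  (`charDivisorSum_eq_card`: `g(n) = #{𝔞 : N𝔞 = n}`) `≤ ½ h_K(16N/√D + 8√N + 1)`;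
* `BellottiPuglisi2023.sum_mul_inv_sqrt_le` — Abel summation: if `G(n) = Σ_{k≤n} g(k) ≤ an + b√n + c`
  (`g ≥ 0`) then `Σ_{n≤N} g(n)/√n ≤ 2a√N + b(1 + log N) + 2c`; hence
  `BellottiPuglisi2023.sum_charDivisorSum_div_sqrt_le`: `Σ_{n≤N} g(n) n^{−½} ≤ h_K(16√N/√D + 4 log N + 5)`
  (the input replacing "Lemma A" in Lemma 4);
* `BellottiPuglisi2023.lemma2_core` — the uniform, explicit form for EVERY `½ ≤ σ ≤ 1`, `s ≠ 1`, `x ≥ 1`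
  (Hoffstein's kernel removes the print's split at `σ = 7/8`, see the companion file):
  `‖Σ_{n≤x} g(n) n^{−s} − ζ(s)L(s,χ)‖ ≤ x^{−σ}·(π h x A_s/√D + C √D (2 log D + 1)(1+|t|)³ +
  65 h (16x/√D + 8√x + 1))`, `A_s = max(1, 1/|1−s|)`, `h = h_K`, `C` absolute — from
  `BPPerron.approx_formula`, the class number formula `L(1,χ) = πh/√D` and the ideal count;
* **`BellottiPuglisi2023.lemma2`** — for `μ > 0` there is `D₀(μ)` such that for `D ≥ D₀`, `h_K ≤ log D`
  (weaker than the print's `h ≤ log q/(log log q)^η`, `η > 1`) and `s ∈ H(ℓ, D)` (`BellottiPuglisi2023.region`,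
  `ℓ = (log log D)^{−μ}`): **`‖Σ_{n≤D} g(n) n^{−s} − ζ(s)L(s,χ)‖ ≤ D^{−ℓ/2}`** (the print's
  `O(exp{−⅓ ℓ log q})`; any `q^{−cℓ}` serves the sequel).

DECLARED DEVIATIONS from print: the saving is stated as `q^{−ℓ/2}` with constant `1` and an (ineffective
in form, effective in substance: a `Filter.eventually_atTop` witness of elementary growth inequalities)
threshold `D₀(μ)`; the hypothesis is `h_K ≤ log q`; `|s|log²` is `(1+|t|)³`.

LABEL (cell rule): instrument / proof layer (kernel). WHAT THIS IS NOT: no claim that a field with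
`h(−q) ≤ log q` and large `q` exists; nothing here bears on parity.

## References

* [BellottiPuglisi2023] Acta Arith. 208 (2023) 257–277 = arXiv:2201.03990v3, §2 Lemma 2 p. 6, Lemma 4 p. 8.
* [DavenportMNT1980] H. Davenport, *Multiplicative Number Theory*, Ch. 6 (ideals of bounded norm, class
  by class — the content of "Lemma 1 of [24]" / "Lemma A").
-/

noncomputable section

open Complex Finset Filter Topology ArithmeticFunction

namespace Literature.NumberTheory.LFunctions

namespace BellottiPuglisi2023

open RealChar Hoffstein1980
open Literature.NumberTheory.QuadraticFields

/-! ### The ideal count: `Σ_{n≤N} g(n) = #{𝔞 ≠ 0 : N𝔞 ≤ N} ≤ ½ h (16N/√D + 8√N + 1)` -/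

section IdealCount

variable {K : Type*} [Field K] [NumberField K] {D : ℕ} [NeZero D] {χ : DirichletCharacter ℂ D}

/-- **`Σ_{n ≤ N} g(n)` counts the non-zero ideals of norm `≤ N`** of the imaginary quadratic field `K`
with `d_K = −D`, for the odd real primitive `χ` mod `D` (`g(n) = Σ_{d∣n}χ(d) = #{𝔞 : N𝔞 = n}`,
`charDivisorSum_eq_card`, grouped by the norm). [cite: DavenportMNT1980, Ch. 6]
[cite: BellottiPuglisi2023, §2 proof of Lemma 2 p. 6 ("Lemma 1 of [24]")] -/
theorem sum_charDivisorSum_eq_ncard (h2 : Module.finrank ℚ K = 2)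
    (hKD : NumberField.discr K = -(D : ℤ)) (hprim : χ.IsPrimitive) (hquad : χ.IsQuadratic)
    (hodd : χ.Odd) (N : ℕ) :
    ∑ n ∈ Icc 1 N, charDivisorSum χ n =
      (Set.ncard {I : Ideal (NumberField.RingOfIntegers K) | I ≠ ⊥ ∧ Ideal.absNorm I ≤ N} : ℝ) := by
  classical
  have hq : χ ^ 2 = 1 := MulChar.IsQuadratic.sq_eq_one hquad
  have hζ : ∀ s : ℂ, 1 < s.re →
      NumberField.dedekindZeta K s = riemannZeta s * LSeries (fun n => χ n) s := fun s hs => by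
    rw [← DirichletCharacter.LFunction_eq_LSeries χ hs]
    exact Quadratic.dedekindZeta_eq_riemannZeta_mul_LFunction_of_odd_primitive hprim hquad hodd h2 hKD hs
  -- the finite set of non-zero ideals of norm `≤ N`
  set S : Finset (Ideal (NumberField.RingOfIntegers K)) :=
    (Ideal.finite_setOf_absNorm_le (S := NumberField.RingOfIntegers K) N).toFinset.filter (fun I => I ≠ ⊥) with hSdef
  have hmemS : ∀ {I : Ideal (NumberField.RingOfIntegers K)}, I ∈ S ↔ I ≠ ⊥ ∧ Ideal.absNorm I ≤ N := by
    intro I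
    rw [hSdef, mem_filter, Set.Finite.mem_toFinset, Set.mem_setOf_eq, and_comm]
  have hset : {I : Ideal (NumberField.RingOfIntegers K) | I ≠ ⊥ ∧ Ideal.absNorm I ≤ N} = ↑S := by
    ext I
    rw [Set.mem_setOf_eq, mem_coe, hmemS]
  rw [hset, Set.ncard_coe_finset]
  -- group by the norm
  have hmaps : ∀ I ∈ S, Ideal.absNorm I ∈ Icc 1 N := by
    intro I hI
    obtain ⟨hI0, hIx⟩ := hmemS.mp hI
    rw [mem_Icc]
    exact ⟨Nat.pos_of_ne_zero (fun h => hI0 (Ideal.absNorm_eq_zero_iff.mp h)), hIx⟩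
  rw [card_eq_sum_card_fiberwise hmaps]
  push_cast
  refine sum_congr rfl fun n hn => ?_
  have hn0 : n ≠ 0 := by rw [mem_Icc] at hn; omega
  have hnN : n ≤ N := (mem_Icc.mp hn).2
  rw [Literature.NumberTheory.DiophantineGeometry.charDivisorSum_eq_card (K := K) hq hζ hn0]
  have hfin : {I : Ideal (NumberField.RingOfIntegers K) | Ideal.absNorm I = n}.Finite := Ideal.finite_setOf_absNorm_eq n
  have hfib : hfin.toFinset = S.filter (fun I => Ideal.absNorm I = n) := by
    ext I
    rw [Set.Finite.mem_toFinset, Set.mem_setOf_eq, mem_filter]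
    constructor
    · intro h
      refine ⟨hmemS.mpr ⟨?_, ?_⟩, h⟩
      · intro hb
        rw [hb, Ideal.absNorm_bot] at h
        exact hn0 h.symm
      · rw [h]; exact hnN
    · exact fun h => h.2
  have hcard : (S.filter (fun I => Ideal.absNorm I = n)).card =
      Nat.card {I : Ideal (NumberField.RingOfIntegers K) // Ideal.absNorm I = n} := by
    rw [← hfib, ← Set.ncard_eq_toFinset_card _ hfin, ← Nat.card_coe_set_eq]
    rfl
  rw [hcard]

/-- **`Σ_{n≤N} g(n) ≤ ½ h_K (16N/√D + 8√N + 1)`** ("Lemma 1 of [24]": `Σ_{n≤x} g(n) ≪ xL(1,χ)` for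
`x ≫ q`; here the tree's class-by-class lattice-point count
`Hallgren2005.card_nonzero_ideals_le_classNumber_mul`). [cite: DavenportMNT1980, Ch. 6]
[cite: BellottiPuglisi2023, §2 proof of Lemma 2 p. 6] -/
theorem sum_charDivisorSum_le (h2 : Module.finrank ℚ K = 2)
    (hKD : NumberField.discr K = -(D : ℤ)) (hprim : χ.IsPrimitive) (hquad : χ.IsQuadratic)
    (hodd : χ.Odd) (N : ℕ) :
    ∑ n ∈ Icc 1 N, charDivisorSum χ n ≤
      1 / 2 * (NumberField.classNumber K : ℝ) * (16 * N / Real.sqrt D + 8 * Real.sqrt N + 1) := by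
  have hd : NumberField.discr K < 0 := by
    rw [hKD, neg_lt_zero]; exact_mod_cast NeZero.pos D
  have hIQ : Literature.NumberTheory.EllipticCurves.IsImaginaryQuadratic K :=
    Literature.NumberTheory.EllipticCurves.isImaginaryQuadratic_iff_discr_neg.mpr ⟨h2, hd⟩
  have h := Literature.Computability.Cryptography.Hallgren2005.card_nonzero_ideals_le_classNumber_mul hIQ N
  rw [hKD] at h
  push_cast at h
  rw [neg_neg] at h
  rw [sum_charDivisorSum_eq_ncard h2 hKD hprim hquad hodd N]
  exact h

end IdealCount

/-! ### Abel summation against `1/√n` -/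

section Abel

/-- Finite Abel summation: `Σ_{n≤N} g(n) f(n) = G(N) f(N) + Σ_{m<N} G(m)(f(m) − f(m+1))`,
`G(m) = Σ_{k≤m} g(k)`. [folklore] -/
private theorem abel_identity (g f : ℕ → ℝ) (N : ℕ) :
    ∑ n ∈ Icc 1 N, g n * f n =
      (∑ n ∈ Icc 1 N, g n) * f N + ∑ m ∈ Ico 1 N, (∑ k ∈ Icc 1 m, g k) * (f m - f (m + 1)) := by
  induction N with
  | zero => simp
  | succ N ih =>
    rw [Finset.sum_Icc_succ_top (by omega), Finset.sum_Icc_succ_top (by omega), ih]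
    rcases Nat.eq_zero_or_pos N with rfl | hN
    · simp
    · rw [Finset.sum_Ico_succ_top hN]
      ring

/-- Telescoping: `Σ_{1≤m<N} (f(m) − f(m+1)) = f(1) − f(N)` for `N ≥ 1`. [folklore] -/
private theorem sum_Ico_sub_succ (f : ℕ → ℝ) {N : ℕ} (hN : 1 ≤ N) :
    ∑ m ∈ Ico 1 N, (f m - f (m + 1)) = f 1 - f N := by
  induction N, hN using Nat.le_induction with
  | base => simp
  | succ N hN ih => rw [Finset.sum_Ico_succ_top hN, ih]; ring

/-- `Σ_{1≤m<N} 1/(m+1) ≤ log N` (`1/(m+1) ≤ log(m+1) − log m`). [folklore] -/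
private theorem sum_Ico_inv_succ_le_log {N : ℕ} (hN : 1 ≤ N) :
    ∑ m ∈ Ico 1 N, 1 / ((m : ℝ) + 1) ≤ Real.log N := by
  induction N, hN using Nat.le_induction with
  | base => simp
  | succ N hN ih =>
    rw [Finset.sum_Ico_succ_top hN]
    have hN0 : (0 : ℝ) < N := by exact_mod_cast hN
    have hN1 : (0 : ℝ) < N + 1 := by linarith
    -- `log((N+1)/N)⁻¹ = log(N/(N+1)) ≤ N/(N+1) − 1 = −1/(N+1)`
    have hlog : 1 / ((N : ℝ) + 1) ≤ Real.log ((N : ℝ) + 1) - Real.log N := by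
      have h := Real.log_le_sub_one_of_pos (show 0 < (N : ℝ) / (N + 1) by positivity)
      rw [Real.log_div hN0.ne' hN1.ne'] at h
      have e : (N : ℝ) / (N + 1) - 1 = -(1 / ((N : ℝ) + 1)) := by field_simp; ring
      rw [e] at h
      linarith
    push_cast
    linarith

/-- `Σ_{1≤m≤N} 1/√m ≤ 2√N` (`1/√(m+1) ≤ 2(√(m+1) − √m)`). [folklore] -/
private theorem sum_Icc_inv_sqrt_le (N : ℕ) :
    ∑ m ∈ Icc 1 N, (Real.sqrt m)⁻¹ ≤ 2 * Real.sqrt N := by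
  induction N with
  | zero => simp
  | succ N ih =>
    rw [Finset.sum_Icc_succ_top (by omega)]
    push_cast
    have hN0 : (0 : ℝ) ≤ N := Nat.cast_nonneg N
    set A := Real.sqrt N with hA
    set B := Real.sqrt ((N : ℝ) + 1) with hB
    have hA0 : 0 ≤ A := Real.sqrt_nonneg _
    have hB0 : 0 < B := Real.sqrt_pos.2 (by linarith)
    have hAB : A ≤ B := Real.sqrt_le_sqrt (by linarith)
    have hsq : B ^ 2 - A ^ 2 = 1 := by
      rw [hA, hB, Real.sq_sqrt (by linarith), Real.sq_sqrt hN0]; ring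
    -- `1/B ≤ 2(B − A)` since `(B − A)(B + A) = 1` and `B + A ≤ 2B`
    have hkey : B⁻¹ ≤ 2 * (B - A) := by
      rw [inv_eq_one_div, div_le_iff₀ hB0]
      nlinarith
    linarith

/-- The basic identity behind the three pointwise bounds: for `m ≥ 1`, with `A = √m`, `B = √(m+1)`,
`1/A − 1/B = 1/(AB(A+B))`. [folklore] -/
private theorem inv_sqrt_sub_inv_sqrt_succ {m : ℕ} (hm : 1 ≤ m) :
    (Real.sqrt m)⁻¹ - (Real.sqrt ((m : ℝ) + 1))⁻¹ =
      1 / (Real.sqrt m * Real.sqrt ((m : ℝ) + 1) * (Real.sqrt m + Real.sqrt ((m : ℝ) + 1))) := by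
  have hm0 : (0 : ℝ) < m := by exact_mod_cast hm
  set A := Real.sqrt m with hA
  set B := Real.sqrt ((m : ℝ) + 1) with hB
  have hA0 : 0 < A := Real.sqrt_pos.2 hm0
  have hB0 : 0 < B := Real.sqrt_pos.2 (by linarith)
  have hsq : B ^ 2 - A ^ 2 = 1 := by
    rw [hA, hB, Real.sq_sqrt (by linarith), Real.sq_sqrt hm0.le]; ring
  have hAB : 0 < A + B := by positivity
  field_simp
  linear_combination hsq

/-- **Abel summation against `1/√n`.** If `G(n) = Σ_{k≤n} g(k) ≤ a n + b√n + c` for all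
`n ≥ 1` (`a, b, c ≥ 0`), then for `N ≥ 1`: `Σ_{n≤N} g(n)/√n ≤ 2a√N + b(1 + log N) + 2c`
(`G(N)/√N ≤ a√N + b + c`; `Σ_{m<N} G(m)(1/√m − 1/√(m+1))` with `m(1/√m − 1/√(m+1)) ≤ 1/(2√m)`,
`√m(1/√m − 1/√(m+1)) ≤ 1/(m+1)`, `Σ(1/√m − 1/√(m+1)) ≤ 1`). [folklore]
[cite: BellottiPuglisi2023, §2 proof of Lemma 4 p. 8 ("Lemma A of [24]")] -/
theorem sum_mul_inv_sqrt_le {g : ℕ → ℝ} {a b c : ℝ} (ha : 0 ≤ a)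
    (hb : 0 ≤ b) (hc : 0 ≤ c)
    (hG : ∀ n : ℕ, 1 ≤ n → ∑ k ∈ Icc 1 n, g k ≤ a * n + b * Real.sqrt n + c) {N : ℕ} (hN : 1 ≤ N) :
    ∑ n ∈ Icc 1 N, g n * (Real.sqrt n)⁻¹ ≤
      2 * a * Real.sqrt N + b * (1 + Real.log N) + 2 * c := by
  set f : ℕ → ℝ := fun n => (Real.sqrt n)⁻¹ with hf
  have hN0 : (0 : ℝ) < N := by exact_mod_cast hN
  have hsN : 0 < Real.sqrt N := Real.sqrt_pos.2 hN0
  have hsN1 : 1 ≤ Real.sqrt N := by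
    rw [show (1 : ℝ) = Real.sqrt 1 by simp]; exact Real.sqrt_le_sqrt (by exact_mod_cast hN)
  rw [show (∑ n ∈ Icc 1 N, g n * (Real.sqrt n)⁻¹) = ∑ n ∈ Icc 1 N, g n * f n from rfl,
    abel_identity g f N]
  -- first term
  have h1 : (∑ n ∈ Icc 1 N, g n) * f N ≤ a * Real.sqrt N + b + c := by
    calc (∑ n ∈ Icc 1 N, g n) * f N ≤ (a * N + b * Real.sqrt N + c) * f N :=
          mul_le_mul_of_nonneg_right (hG N hN) (by simp [hf])
      _ = a * (N / Real.sqrt N) + b + c / Real.sqrt N := by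
          simp only [hf]; field_simp
      _ = a * Real.sqrt N + b + c / Real.sqrt N := by rw [Real.div_sqrt]
      _ ≤ a * Real.sqrt N + b + c := by
          gcongr
          exact div_le_self hc hsN1
  -- pointwise facts on `Ico 1 N`
  have hpt : ∀ m ∈ Ico 1 N,
      0 ≤ f m - f (m + 1) ∧ (m : ℝ) * (f m - f (m + 1)) ≤ f m / 2 ∧
        Real.sqrt m * (f m - f (m + 1)) ≤ 1 / ((m : ℝ) + 1) := by
    intro m hm
    have hm1 : 1 ≤ m := (mem_Ico.mp hm).1
    have hm0 : (0 : ℝ) < m := by exact_mod_cast hm1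
    have hAm : Real.sqrt m ^ 2 = m := Real.sq_sqrt hm0.le
    have hBm : Real.sqrt ((m : ℝ) + 1) ^ 2 = m + 1 := Real.sq_sqrt (by linarith)
    set A := Real.sqrt m with hA
    set B := Real.sqrt ((m : ℝ) + 1) with hB
    have hA0 : 0 < A := Real.sqrt_pos.2 hm0
    have hB0 : 0 < B := Real.sqrt_pos.2 (by linarith)
    have hAB : A ≤ B := Real.sqrt_le_sqrt (by linarith)
    have hfm : f m = A⁻¹ := by simp [hf, hA]
    have hfm1 : f (m + 1) = B⁻¹ := by simp [hf, hB]
    have hdiff : f m - f (m + 1) = 1 / (A * B * (A + B)) := by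
      rw [hfm, hfm1]; exact inv_sqrt_sub_inv_sqrt_succ hm1
    have hABpos : 0 < A * B * (A + B) := by positivity
    refine ⟨by rw [hdiff]; positivity, ?_, ?_⟩
    · -- `m/(AB(A+B)) ≤ 1/(2A)` iff `2m ≤ A⁻¹·AB(A+B) = AB + B² = AB + m + 1`, and `AB ≥ A² = m`
      rw [hdiff, hfm, mul_one_div, div_le_div_iff₀ hABpos (by norm_num : (0:ℝ) < 2)]
      have hABge : (m : ℝ) ≤ A * B := by rw [← hAm, sq]; exact mul_le_mul_of_nonneg_left hAB hA0.le
      have e : A⁻¹ * (A * B * (A + B)) = A * B + B ^ 2 := by field_simp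
      rw [e, hBm]
      nlinarith
    · -- `A/(AB(A+B)) = 1/(B(A+B)) ≤ 1/(m+1)` since `B(A+B) ≥ B² = m + 1`
      rw [hdiff, mul_one_div, div_le_div_iff₀ hABpos (by linarith), one_mul]
      have : ((m : ℝ) + 1) * A ≤ A * B * (A + B) := by
        rw [← hBm]; nlinarith [mul_nonneg hA0.le hB0.le, sq_nonneg B]
      linarith
  -- second term
  have h2 : ∑ m ∈ Ico 1 N, (∑ k ∈ Icc 1 m, g k) * (f m - f (m + 1)) ≤
      a * Real.sqrt N + b * Real.log N + c := by
    have hstep : ∀ m ∈ Ico 1 N, (∑ k ∈ Icc 1 m, g k) * (f m - f (m + 1)) ≤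
        a * (f m / 2) + b * (1 / ((m : ℝ) + 1)) + c * (f m - f (m + 1)) := by
      intro m hm
      have hm1 : 1 ≤ m := (mem_Ico.mp hm).1
      obtain ⟨hd0, hmA, hmB⟩ := hpt m hm
      calc (∑ k ∈ Icc 1 m, g k) * (f m - f (m + 1))
          ≤ (a * m + b * Real.sqrt m + c) * (f m - f (m + 1)) :=
            mul_le_mul_of_nonneg_right (hG m hm1) hd0
        _ = a * ((m : ℝ) * (f m - f (m + 1))) + b * (Real.sqrt m * (f m - f (m + 1))) +
              c * (f m - f (m + 1)) := by ring
        _ ≤ a * (f m / 2) + b * (1 / ((m : ℝ) + 1)) + c * (f m - f (m + 1)) := by gcongr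
    have hsumf : ∑ m ∈ Ico 1 N, f m ≤ 2 * Real.sqrt N := by
      calc ∑ m ∈ Ico 1 N, f m ≤ ∑ m ∈ Icc 1 N, f m :=
            Finset.sum_le_sum_of_subset_of_nonneg Finset.Ico_subset_Icc_self
              (fun m _ _ => by simp [hf])
        _ ≤ 2 * Real.sqrt N := sum_Icc_inv_sqrt_le N
    have htel : ∑ m ∈ Ico 1 N, (f m - f (m + 1)) ≤ 1 := by
      rw [sum_Ico_sub_succ f hN]
      have : f 1 = 1 := by simp [hf]
      rw [this]
      have : 0 ≤ f N := by simp [hf]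
      linarith
    calc ∑ m ∈ Ico 1 N, (∑ k ∈ Icc 1 m, g k) * (f m - f (m + 1))
        ≤ ∑ m ∈ Ico 1 N, (a * (f m / 2) + b * (1 / ((m : ℝ) + 1)) + c * (f m - f (m + 1))) :=
          Finset.sum_le_sum hstep
      _ = a / 2 * ∑ m ∈ Ico 1 N, f m + b * ∑ m ∈ Ico 1 N, 1 / ((m : ℝ) + 1) +
            c * ∑ m ∈ Ico 1 N, (f m - f (m + 1)) := by
          rw [Finset.sum_add_distrib, Finset.sum_add_distrib, ← Finset.mul_sum, ← Finset.mul_sum,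
            ← Finset.mul_sum]
          congr 1; congr 1
          rw [Finset.mul_sum, Finset.mul_sum]
          exact Finset.sum_congr rfl fun m _ => by ring
      _ ≤ a / 2 * (2 * Real.sqrt N) + b * Real.log N + c * 1 := by
          gcongr
          · exact sum_Ico_inv_succ_le_log hN
      _ = a * Real.sqrt N + b * Real.log N + c := by ring
  linarith

end Abel

/-! ### `Σ_{n≤N} g(n)/√n ≤ h(16√N/√D + 4 log N + 5)` (the replacement of "Lemma A") -/

section DivSqrt

variable {K : Type*} [Field K] [NumberField K] {D : ℕ} [NeZero D] {χ : DirichletCharacter ℂ D}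

/-- **`Σ_{n≤N} g(n)/√n ≤ h_K (16√N/√D + 4(1 + log N) + 1)`** for the field `K` with `d_K = −D` and
its odd real primitive character (Abel summation of the class-by-class ideal count). With `N = D`:
`≤ h_K(21 + 4 log D)`. [cite: BellottiPuglisi2023, §2 proof of Lemma 4 p. 8 ("Lemma A of [24]")]
[cite: DavenportMNT1980, Ch. 6] -/
theorem sum_charDivisorSum_div_sqrt_le (h2 : Module.finrank ℚ K = 2)
    (hKD : NumberField.discr K = -(D : ℤ)) (hprim : χ.IsPrimitive) (hquad : χ.IsQuadratic)
    (hodd : χ.Odd) {N : ℕ} (hN : 1 ≤ N) :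
    ∑ n ∈ Icc 1 N, charDivisorSum χ n * (Real.sqrt n)⁻¹ ≤
      (NumberField.classNumber K : ℝ) *
        (16 * Real.sqrt N / Real.sqrt D + 4 * (1 + Real.log N) + 1) := by
  have hq : χ ^ 2 = 1 := MulChar.IsQuadratic.sq_eq_one hquad
  set h : ℝ := (NumberField.classNumber K : ℝ) with hh
  have hh0 : 0 ≤ h := by rw [hh]; positivity
  have hD0 : (0 : ℝ) < D := by exact_mod_cast NeZero.pos D
  have hsD : 0 < Real.sqrt D := Real.sqrt_pos.2 hD0
  have hG : ∀ n : ℕ, 1 ≤ n → ∑ k ∈ Icc 1 n, charDivisorSum χ k ≤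
      (8 * h / Real.sqrt D) * n + (4 * h) * Real.sqrt n + h / 2 := by
    intro n _
    have := sum_charDivisorSum_le (K := K) h2 hKD hprim hquad hodd n
    rw [← hh] at this
    calc ∑ k ∈ Icc 1 n, charDivisorSum χ k ≤ 1 / 2 * h * (16 * n / Real.sqrt D + 8 * Real.sqrt n + 1) :=
          this
      _ = (8 * h / Real.sqrt D) * n + (4 * h) * Real.sqrt n + h / 2 := by field_simp; ring
  have hmain := sum_mul_inv_sqrt_le (by positivity) (by positivity) (by positivity) hG hN
  calc ∑ n ∈ Icc 1 N, charDivisorSum χ n * (Real.sqrt n)⁻¹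
      ≤ 2 * (8 * h / Real.sqrt D) * Real.sqrt N + (4 * h) * (1 + Real.log N) + 2 * (h / 2) := hmain
    _ = h * (16 * Real.sqrt N / Real.sqrt D + 4 * (1 + Real.log N) + 1) := by
        field_simp; ring

end DivSqrt

/-! ### Lemma 2: the uniform explicit form, and the form on `H(ℓ, q)` -/

section LemmaTwo

/-- **Lemma 2, uniform core.** There is an absolute `C` such that for every imaginary quadratic field
`K` with `d_K = −D`, `D ≥ 5`, its odd real primitive character `χ` mod `D`, every `s = σ + it` with
`½ ≤ σ ≤ 1`, `s ≠ 1`, and every `x ≥ 1`: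
`‖Σ_{n≤x} g(n) n^{−s} − ζ(s)L(s,χ)‖ ≤ x^{−σ}(π h x A_s/√D + C√D(2 log D + 1)(1+|t|)³ + 65h(16x/√D + 8√x + 1))`,
`h = h_K`, `A_s = max(1, 1/|1−s|)` (`BPPerron.approx_formula` + `L(1,χ) = πh/√D` + the ideal count).
[cite: BellottiPuglisi2023, §2 Lemma 2 p. 6] -/
theorem lemma2_core :
    ∃ C : ℝ, 0 < C ∧ ∀ (D : ℕ) [NeZero D] (K : Type) [Field K] [NumberField K],
      Module.finrank ℚ K = 2 → NumberField.discr K = -(D : ℤ) → 5 ≤ D →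
      ∀ χ : DirichletCharacter ℂ D, χ.IsQuadratic → χ.IsPrimitive → χ.Odd →
      ∀ s : ℂ, 1 / 2 ≤ s.re → s.re ≤ 1 → s ≠ 1 → ∀ x : ℝ, 1 ≤ x →
        ‖(∑ n ∈ Icc 1 ⌊x⌋₊, (charDivisorSum χ n : ℂ) * (n : ℂ) ^ (-s)) -
            riemannZeta s * χ.LFunction s‖ ≤
          x ^ (-s.re) *
            (Real.pi * (NumberField.classNumber K : ℝ) * x * max 1 (1 / ‖1 - s‖) / Real.sqrt D +
              C * (Real.sqrt D * (2 * Real.log D + 1)) * (1 + |s.im|) ^ 3 +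
              65 * (NumberField.classNumber K : ℝ) * (16 * x / Real.sqrt D + 8 * Real.sqrt x + 1)) := by
  obtain ⟨C, hC, happrox⟩ := BPPerron.approx_formula
  refine ⟨C, hC, ?_⟩
  intro D _ K _ _ h2 hKD hD5 χ hquad hprim hodd s hσ0 hσ1 hs1 x hx1
  have hq : χ ^ 2 = 1 := MulChar.IsQuadratic.sq_eq_one hquad
  have hD3 : 3 ≤ D := le_trans (by norm_num) hD5
  have hx0 : 0 < x := by linarith
  have hD0 : (0 : ℝ) < D := by exact_mod_cast NeZero.pos D
  have hsD : 0 < Real.sqrt D := Real.sqrt_pos.2 hD0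
  have hd : NumberField.discr K < 0 := by rw [hKD, neg_lt_zero]; exact_mod_cast NeZero.pos D
  have hne : χ ≠ 1 := by
    intro h1
    have h := hodd
    rw [DirichletCharacter.Odd, h1, MulChar.one_apply isUnit_one.neg] at h
    norm_num at h
  have hmain := happrox hD3 hprim hq hσ0 hσ1 hs1 hx1
  -- class number formula `L(1) = π h/√D`
  set h : ℝ := (NumberField.classNumber K : ℝ) with hh
  have hh0 : 0 ≤ h := by rw [hh]; positivity
  have hd4 : NumberField.discr K < -4 := by rw [hKD]; omega
  have hcnf := Quadratic.LFunction_one_eq_of_discr_neg_of_eq h2 hd hne (fun s hs => by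
    rw [← DirichletCharacter.LFunction_eq_LSeries χ (show 1 < (s : ℂ).re by simpa using hs)]
    exact Quadratic.dedekindZeta_eq_riemannZeta_mul_LFunction_of_odd_primitive hprim hquad hodd
      h2 hKD (by simpa using hs))
  have hw : (NumberField.Units.torsionOrder K : ℝ) = 2 := by
    exact_mod_cast Quadratic.torsionOrder_eq_two_of_discr_lt_neg_four h2 hd4
  have habs : |(NumberField.discr K : ℝ)| = (D : ℝ) := by
    rw [hKD]; push_cast; rw [abs_neg]; exact abs_of_pos hD0
  have hL1 : χ.LFunction 1 = ((Real.pi * h / Real.sqrt D : ℝ) : ℂ) := by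
    rw [hcnf, hw, habs, hh, mul_assoc, mul_div_mul_left _ _ (two_ne_zero' ℝ)]
  have hL1norm : ‖χ.LFunction 1‖ = Real.pi * h / Real.sqrt D := by
    rw [hL1, Complex.norm_real, Real.norm_eq_abs, abs_of_nonneg (by positivity)]
  -- the three terms
  have hK := BPPerron.norm_hoffKernel_one_sub_le hσ1 hs1
  have hA0 : 0 ≤ max 1 (1 / ‖1 - s‖) := le_trans zero_le_one (le_max_left _ _)
  have hT1 : 720 * ‖χ.LFunction 1‖ * x ^ (1 - s.re) * ‖hoffKernel (1 - s)‖ ≤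
      x ^ (-s.re) * (Real.pi * h * x * max 1 (1 / ‖1 - s‖) / Real.sqrt D) := by
    rw [hL1norm]
    have e : x ^ (1 - s.re) = x * x ^ (-s.re) := by
      rw [show (1 - s.re) = 1 + -s.re by ring, Real.rpow_add hx0, Real.rpow_one]
    rw [e]
    calc 720 * (Real.pi * h / Real.sqrt D) * (x * x ^ (-s.re)) * ‖hoffKernel (1 - s)‖
        ≤ 720 * (Real.pi * h / Real.sqrt D) * (x * x ^ (-s.re)) * (max 1 (1 / ‖1 - s‖) / 720) := by
          gcongr
      _ = x ^ (-s.re) * (Real.pi * h * x * max 1 (1 / ‖1 - s‖) / Real.sqrt D) := by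
          field_simp
  have hT3 : 129 * x ^ (-s.re) * ∑ n ∈ Icc 1 ⌊x⌋₊, charDivisorSum χ n ≤
      x ^ (-s.re) * (65 * h * (16 * x / Real.sqrt D + 8 * Real.sqrt x + 1)) := by
    have hcount := sum_charDivisorSum_le (K := K) h2 hKD hprim hquad hodd ⌊x⌋₊
    rw [← hh] at hcount
    have hfl : (⌊x⌋₊ : ℝ) ≤ x := Nat.floor_le hx0.le
    have hcount' : ∑ n ∈ Icc 1 ⌊x⌋₊, charDivisorSum χ n ≤
        1 / 2 * h * (16 * x / Real.sqrt D + 8 * Real.sqrt x + 1) := by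
      refine hcount.trans ?_
      gcongr
    have hxσ : 0 ≤ x ^ (-s.re) := Real.rpow_nonneg hx0.le _
    calc 129 * x ^ (-s.re) * ∑ n ∈ Icc 1 ⌊x⌋₊, charDivisorSum χ n
        ≤ 129 * x ^ (-s.re) * (1 / 2 * h * (16 * x / Real.sqrt D + 8 * Real.sqrt x + 1)) := by
          gcongr
      _ ≤ x ^ (-s.re) * (65 * h * (16 * x / Real.sqrt D + 8 * Real.sqrt x + 1)) := by
          have : 0 ≤ h * (16 * x / Real.sqrt D + 8 * Real.sqrt x + 1) := by positivity
          nlinarith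
  calc ‖(∑ n ∈ Icc 1 ⌊x⌋₊, (charDivisorSum χ n : ℂ) * (n : ℂ) ^ (-s)) - riemannZeta s * χ.LFunction s‖
      ≤ 720 * ‖χ.LFunction 1‖ * x ^ (1 - s.re) * ‖hoffKernel (1 - s)‖ +
          C * (Real.sqrt D * (2 * Real.log D + 1)) * (1 + |s.im|) ^ 3 * x ^ (-s.re) +
          129 * x ^ (-s.re) * ∑ n ∈ Icc 1 ⌊x⌋₊, charDivisorSum χ n := hmain
    _ ≤ x ^ (-s.re) * (Real.pi * h * x * max 1 (1 / ‖1 - s‖) / Real.sqrt D) +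
          C * (Real.sqrt D * (2 * Real.log D + 1)) * (1 + |s.im|) ^ 3 * x ^ (-s.re) +
          x ^ (-s.re) * (65 * h * (16 * x / Real.sqrt D + 8 * Real.sqrt x + 1)) :=
        add_le_add (add_le_add hT1 le_rfl) hT3
    _ = _ := by ring

/-- The elementary growth facts behind "for `q` sufficiently large" in Lemma 2: for all large real `X`
(`X = log q`), `5(log X)^μ(|log C₂| + 5 log X) ≤ X`, `log X ≥ 1` and `X ≥ 1`. [folklore] -/
private theorem eventually_thresholds (μ : ℝ) (C₂ : ℝ) :
    ∃ X₀ : ℝ, ∀ X : ℝ, X₀ ≤ X →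
      1 ≤ X ∧ 1 ≤ Real.log X ∧ 5 * Real.log X ^ μ * (|Real.log C₂| + 5 * Real.log X) ≤ X := by
  set A : ℝ := 5 * |Real.log C₂| + 25 with hA
  have hA0 : 0 < A := by positivity
  have h1 : ∀ᶠ X : ℝ in atTop, 1 ≤ X := Filter.eventually_ge_atTop 1
  have h2 : ∀ᶠ X : ℝ in atTop, 1 ≤ Real.log X := Real.tendsto_log_atTop.eventually_ge_atTop 1
  have h3 : ∀ᶠ X : ℝ in atTop, A * Real.log X ^ (μ + 1) ≤ X := by
    have hb := (isLittleO_log_rpow_rpow_atTop (μ + 1) (by norm_num : (0:ℝ) < 1)).bound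
      (show 0 < 1 / A by positivity)
    filter_upwards [hb, Filter.eventually_ge_atTop 1] with X hX hX1
    rw [Real.rpow_one, Real.norm_of_nonneg (Real.rpow_nonneg (Real.log_nonneg hX1) _),
      Real.norm_of_nonneg (by linarith)] at hX
    calc A * Real.log X ^ (μ + 1) ≤ A * (1 / A * X) := by gcongr
      _ = X := by field_simp
  obtain ⟨X₀, hX₀⟩ := Filter.eventually_atTop.mp (h1.and (h2.and h3))
  refine ⟨X₀, fun X hX => ?_⟩
  obtain ⟨hX1, hlX1, hX3⟩ := hX₀ X hX
  refine ⟨hX1, hlX1, le_trans ?_ hX3⟩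
  have hl0 : 0 < Real.log X := by linarith
  have hsplit : Real.log X ^ (μ + 1) = Real.log X ^ μ * Real.log X := by
    rw [Real.rpow_add hl0, Real.rpow_one]
  have hμ1 : Real.log X ^ μ ≤ Real.log X ^ (μ + 1) := by
    rw [hsplit]
    exact le_mul_of_one_le_right (Real.rpow_nonneg hl0.le _) hlX1
  have hlμ0 : 0 ≤ Real.log X ^ μ := Real.rpow_nonneg hl0.le _
  calc 5 * Real.log X ^ μ * (|Real.log C₂| + 5 * Real.log X)
      = 5 * |Real.log C₂| * Real.log X ^ μ + 25 * (Real.log X ^ μ * Real.log X) := by ring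
    _ ≤ 5 * |Real.log C₂| * Real.log X ^ (μ + 1) + 25 * Real.log X ^ (μ + 1) := by
        rw [← hsplit]; gcongr
    _ = A * Real.log X ^ (μ + 1) := by rw [hA]; ring

/-- **Bellotti–Puglisi's Lemma 2 (on `H(ℓ, q)`, threshold form).** For `μ > 0` there is `D₀` such that
for every imaginary quadratic field `K` with `d_K = −D`, `D ≥ D₀`, `h_K ≤ log D`, its odd real primitive
character `χ` mod `D`, and every `s ∈ H(ℓ, D)` (`ℓ = (log log D)^{−μ}`):
`‖Σ_{n≤D} g(n) n^{−s} − ζ(s)L(s,χ)‖ ≤ D^{−ℓ/2}`. (Print: `= L(s,χ)ζ(s) + O(exp{−⅓ log q/(log log q)^μ})`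
under `h(−q) ≤ log q/(log log q)^η`.) [cite: BellottiPuglisi2023, §2 Lemma 2 p. 6] -/
theorem lemma2 {μ : ℝ} (hμ : 0 < μ) :
    ∃ D₀ : ℕ, ∀ (D : ℕ) [NeZero D] (K : Type) [Field K] [NumberField K],
      Module.finrank ℚ K = 2 → NumberField.discr K = -(D : ℤ) → D₀ ≤ D →
      (NumberField.classNumber K : ℝ) ≤ Real.log D →
      ∀ χ : DirichletCharacter ℂ D, χ.IsQuadratic → χ.IsPrimitive → χ.Odd →
      ∀ s : ℂ, s ∈ region μ D →
        ‖(∑ n ∈ Icc 1 D, (charDivisorSum χ n : ℂ) * (n : ℂ) ^ (-s)) -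
            riemannZeta s * χ.LFunction s‖ ≤
          (D : ℝ) ^ (-(Real.log (Real.log D)) ^ (-μ) / 2) := by
  obtain ⟨C, hC, hcore⟩ := lemma2_core
  -- the constant collecting the three terms: `π log⁵ + 24 C log⁵ + 1625 log⁵`
  set C₂ : ℝ := Real.pi + 24 * C + 1625 with hC₂
  have hC₂0 : 0 < C₂ := by rw [hC₂]; positivity
  obtain ⟨X₀, hX₀⟩ := eventually_thresholds μ C₂
  refine ⟨max 16 ⌈Real.exp X₀⌉₊, ?_⟩
  intro D _ K _ _ h2 hKD hD0le hh χ hquad hprim hodd s hs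
  have hD16 : 16 ≤ D := le_trans (le_max_left _ _) hD0le
  have hDX : ⌈Real.exp X₀⌉₊ ≤ D := le_trans (le_max_right _ _) hD0le
  have hD5 : 5 ≤ D := le_trans (by norm_num) hD16
  have hDr : (16 : ℝ) ≤ D := by exact_mod_cast hD16
  have hD0 : (0 : ℝ) < D := by linarith
  have hD1 : (1 : ℝ) < D := by linarith
  set X : ℝ := Real.log D with hX
  -- `X ≥ X₀`
  have hXX₀ : X₀ ≤ X := by
    have h1 : Real.exp X₀ ≤ D := le_trans (Nat.le_ceil _) (by exact_mod_cast hDX)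
    rw [hX, Real.le_log_iff_exp_le hD0]; exact h1
  obtain ⟨hX1, hlX1, hthr⟩ := hX₀ X hXX₀
  have hX0 : 0 < X := by linarith
  have hlX0 : 0 < Real.log X := by linarith
  set ℓ : ℝ := Real.log X ^ (-μ) with hℓ
  have hℓ0 : 0 < ℓ := Real.rpow_pos_of_pos hlX0 _
  have hℓ1 : ℓ ≤ 1 := by
    rw [hℓ, Real.rpow_neg hlX0.le]
    exact inv_le_one_of_one_le₀ (Real.one_le_rpow hlX1 hμ.le)
  -- unpack the region
  obtain ⟨hs1', hσ0', hσ1, hsnorm⟩ := hs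
  rw [← hX] at hs1' hσ0' hsnorm
  rw [← hℓ] at hσ0' hsnorm
  have hσ0 : 1 / 2 ≤ s.re := by linarith
  have hs1 : s ≠ 1 := by
    intro h; rw [h, sub_self, norm_zero] at hs1'
    exact absurd hs1' (not_le.mpr (Real.rpow_pos_of_pos hX0 _))
  -- the core estimate at `x = D`
  have hmain := hcore D K h2 hKD hD5 χ hquad hprim hodd s hσ0 hσ1 hs1 (D : ℝ) hD1.le
  rw [Nat.floor_natCast] at hmain
  set h : ℝ := (NumberField.classNumber K : ℝ) with hhdef
  have hh0 : 0 ≤ h := by rw [hhdef]; positivity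
  have hsD : 0 < Real.sqrt D := Real.sqrt_pos.2 hD0
  have hsD2 : Real.sqrt D * Real.sqrt D = D := Real.mul_self_sqrt hD0.le
  -- `A_s ≤ X⁴`, `(1+|t|)³ ≤ 8 D^{3ℓ/10}`, `h ≤ X`, `2 log D + 1 ≤ 3X`, `1 ≤ X⁴`
  have hA : max 1 (1 / ‖1 - s‖) ≤ X ^ 4 := by
    refine max_le ?_ ?_
    · exact one_le_pow₀ hX1
    · have hpos : 0 < X ^ (-(4:ℝ)) := Real.rpow_pos_of_pos hX0 _
      rw [div_le_iff₀ (lt_of_lt_of_le hpos hs1')]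
      calc (1 : ℝ) = X ^ 4 * X ^ (-(4 : ℝ)) := by
            rw [show (X ^ 4 : ℝ) = X ^ (4 : ℝ) by norm_cast, ← Real.rpow_add hX0]; simp
        _ ≤ X ^ 4 * ‖1 - s‖ := by gcongr
  have ht : (1 + |s.im|) ^ 3 ≤ 8 * (D : ℝ) ^ (3 * ℓ / 10) := by
    have h1 : |s.im| ≤ (D : ℝ) ^ (ℓ / 10) := (Complex.abs_im_le_norm s).trans hsnorm
    have h2 : (1 : ℝ) ≤ (D : ℝ) ^ (ℓ / 10) := Real.one_le_rpow hD1.le (by positivity)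
    calc (1 + |s.im|) ^ 3 ≤ ((D : ℝ) ^ (ℓ / 10) + (D : ℝ) ^ (ℓ / 10)) ^ 3 := by gcongr
      _ = 8 * ((D : ℝ) ^ (ℓ / 10)) ^ 3 := by ring
      _ = 8 * (D : ℝ) ^ (3 * ℓ / 10) := by
          rw [← Real.rpow_natCast, ← Real.rpow_mul hD0.le,
            show ℓ / 10 * ((3 : ℕ) : ℝ) = 3 * ℓ / 10 by push_cast; ring]
  have hlog3 : 2 * Real.log D + 1 ≤ 3 * X := by rw [← hX]; linarith
  have hX4 : 1 ≤ X ^ 4 := one_le_pow₀ hX1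
  have hX5 : X ≤ X ^ 5 := by
    calc X = X ^ 1 := (pow_one X).symm
      _ ≤ X ^ 5 := pow_le_pow_right₀ hX1 (by norm_num)
  have hDℓ1 : 1 ≤ (D : ℝ) ^ (3 * ℓ / 10) := Real.one_le_rpow hD1.le (by positivity)
  -- the bracket `≤ √D · D^{3ℓ/10} · C₂ X⁵`
  have hbr : Real.pi * h * D * max 1 (1 / ‖1 - s‖) / Real.sqrt D +
      C * (Real.sqrt D * (2 * Real.log D + 1)) * (1 + |s.im|) ^ 3 +
      65 * h * (16 * D / Real.sqrt D + 8 * Real.sqrt D + 1) ≤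
      Real.sqrt D * (D : ℝ) ^ (3 * ℓ / 10) * (C₂ * X ^ 5) := by
    have e1 : (D : ℝ) / Real.sqrt D = Real.sqrt D := by
      rw [div_eq_iff hsD.ne', hsD2]
    have hsD1 : 1 ≤ Real.sqrt D := by
      rw [show (1:ℝ) = Real.sqrt 1 by simp]; exact Real.sqrt_le_sqrt hD1.le
    -- term 1
    have t1 : Real.pi * h * D * max 1 (1 / ‖1 - s‖) / Real.sqrt D ≤
        Real.sqrt D * (D : ℝ) ^ (3 * ℓ / 10) * (Real.pi * X ^ 5) := by
      calc Real.pi * h * D * max 1 (1 / ‖1 - s‖) / Real.sqrt D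
          = Real.pi * h * max 1 (1 / ‖1 - s‖) * ((D : ℝ) / Real.sqrt D) := by ring
        _ ≤ Real.pi * X * X ^ 4 * (Real.sqrt D * (D : ℝ) ^ (3 * ℓ / 10)) := by
            rw [e1]; gcongr; exact le_mul_of_one_le_right hsD.le hDℓ1
        _ = Real.sqrt D * (D : ℝ) ^ (3 * ℓ / 10) * (Real.pi * X ^ 5) := by ring
    -- term 2
    have t2 : C * (Real.sqrt D * (2 * Real.log D + 1)) * (1 + |s.im|) ^ 3 ≤
        Real.sqrt D * (D : ℝ) ^ (3 * ℓ / 10) * (24 * C * X ^ 5) := by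
      calc C * (Real.sqrt D * (2 * Real.log D + 1)) * (1 + |s.im|) ^ 3
          ≤ C * (Real.sqrt D * (3 * X)) * (8 * (D : ℝ) ^ (3 * ℓ / 10)) := by gcongr
        _ = Real.sqrt D * (D : ℝ) ^ (3 * ℓ / 10) * (24 * C * X) := by ring
        _ ≤ Real.sqrt D * (D : ℝ) ^ (3 * ℓ / 10) * (24 * C * X ^ 5) := by gcongr
    -- term 3
    have t3 : 65 * h * (16 * D / Real.sqrt D + 8 * Real.sqrt D + 1) ≤
        Real.sqrt D * (D : ℝ) ^ (3 * ℓ / 10) * (1625 * X ^ 5) := by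
      have : 16 * D / Real.sqrt D + 8 * Real.sqrt D + 1 ≤ 25 * Real.sqrt D := by
        rw [mul_div_assoc, e1]; linarith
      calc 65 * h * (16 * D / Real.sqrt D + 8 * Real.sqrt D + 1)
          ≤ 65 * X ^ 5 * (25 * (Real.sqrt D * (D : ℝ) ^ (3 * ℓ / 10))) := by
            gcongr
            · exact hh.trans hX5
            · exact this.trans (by
                have := le_mul_of_one_le_right hsD.le hDℓ1; linarith)
        _ = Real.sqrt D * (D : ℝ) ^ (3 * ℓ / 10) * (1625 * X ^ 5) := by ring
    calc _ ≤ Real.sqrt D * (D : ℝ) ^ (3 * ℓ / 10) * (Real.pi * X ^ 5) +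
          Real.sqrt D * (D : ℝ) ^ (3 * ℓ / 10) * (24 * C * X ^ 5) +
          Real.sqrt D * (D : ℝ) ^ (3 * ℓ / 10) * (1625 * X ^ 5) := add_le_add (add_le_add t1 t2) t3
      _ = Real.sqrt D * (D : ℝ) ^ (3 * ℓ / 10) * (C₂ * X ^ 5) := by rw [hC₂]; ring
  -- the threshold: `C₂ X⁵ ≤ D^{ℓ/5} = exp(ℓ X/5)`
  have hthr' : C₂ * X ^ 5 ≤ (D : ℝ) ^ (ℓ / 5) := by
    have hlμ0 : 0 < Real.log X ^ μ := Real.rpow_pos_of_pos hlX0 _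
    have key : 5 * Real.log X ^ μ * (Real.log C₂ + 5 * Real.log X) ≤ X := by
      refine le_trans ?_ hthr
      gcongr
      exact le_abs_self _
    have hlogle : Real.log (C₂ * X ^ 5) ≤ X * (ℓ / 5) := by
      rw [Real.log_mul hC₂0.ne' (by positivity), Real.log_pow]
      push_cast
      have e : X * (ℓ / 5) = X / (5 * Real.log X ^ μ) := by
        rw [hℓ, Real.rpow_neg hlX0.le]; field_simp
      rw [e, le_div_iff₀ (by positivity)]
      linarith
    calc C₂ * X ^ 5 = Real.exp (Real.log (C₂ * X ^ 5)) := (Real.exp_log (by positivity)).symm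
      _ ≤ Real.exp (X * (ℓ / 5)) := Real.exp_le_exp.mpr hlogle
      _ = (D : ℝ) ^ (ℓ / 5) := by rw [Real.rpow_def_of_pos hD0, hX]
  -- exponent bookkeeping: `D^{-σ} √D D^{3ℓ/10} D^{ℓ/5} ≤ D^{-ℓ/2}`
  have hexp : (D : ℝ) ^ (-s.re) * (Real.sqrt D * (D : ℝ) ^ (3 * ℓ / 10) * (D : ℝ) ^ (ℓ / 5)) ≤
      (D : ℝ) ^ (-ℓ / 2) := by
    rw [Real.sqrt_eq_rpow, ← Real.rpow_add hD0, ← Real.rpow_add hD0, ← Real.rpow_add hD0]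
    refine Real.rpow_le_rpow_of_exponent_le hD1.le ?_
    linarith
  calc ‖(∑ n ∈ Icc 1 D, (charDivisorSum χ n : ℂ) * (n : ℂ) ^ (-s)) - riemannZeta s * χ.LFunction s‖
      ≤ (D : ℝ) ^ (-s.re) * (Real.pi * h * D * max 1 (1 / ‖1 - s‖) / Real.sqrt D +
          C * (Real.sqrt D * (2 * Real.log D + 1)) * (1 + |s.im|) ^ 3 +
          65 * h * (16 * D / Real.sqrt D + 8 * Real.sqrt D + 1)) := hmain
    _ ≤ (D : ℝ) ^ (-s.re) * (Real.sqrt D * (D : ℝ) ^ (3 * ℓ / 10) * (C₂ * X ^ 5)) := by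
        gcongr
    _ ≤ (D : ℝ) ^ (-s.re) * (Real.sqrt D * (D : ℝ) ^ (3 * ℓ / 10) * (D : ℝ) ^ (ℓ / 5)) := by
        gcongr
    _ ≤ (D : ℝ) ^ (-ℓ / 2) := hexp
    _ = (D : ℝ) ^ (-(Real.log (Real.log D)) ^ (-μ) / 2) := by rw [hℓ, hX, neg_div]

end LemmaTwo

end BellottiPuglisi2023

end Literature.NumberTheory.LFunctions

end
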